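import Literature.NumberTheory.Automorphic.Liu2021.Map43Injective
import Literature.NumberTheory.Automorphic.Liu2021.Thm418BlockLeRange
import HarnessLib

/-!
# [Liu 2021, Thm. 4.18] AS PRINTED ⟹ the combined reading r8 at one `μ` — with the proof map (4.3) presented through RATIONAL
# `H¹` (no «(4.3) is injective» binder)

Y. Liu, *Fourier–Jacobi cycles and arithmetic relative trace formula*, Camb. J. Math. **9** (2021) 1–147 = arXiv:2102.11518
[Liu2021]; TeX source `FJcycle.tex` (md5 `6db49a74122d2cb0f224fa1b39488a0c`; `l. NNNN` = its lines).

## What this file is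

The Δ2 bridge of record «[Liu2021] Thm. 4.18 EXACTLY AS PRINTED ⟹ the stage-1 package's combined reading r8 (`Thm418Combined` /
`Thm418C`) at one `μ`» is the pair `Thm418Data.block_resW_mem_span_of_thm418AsPrinted_act` (`Thm418CombinedReading.lean`, pin-3:
item (1) + the (4.3)-carrier ⟹ the `hmap` clause) and `Thm418Data.iSup_range_resW_mem_span_of_thm418AsPrinted_of_rank_le_one`
(`Thm418BlockLeRange.lean`, this lineage: + multiplicity one ⟹ `hblock`).  Both carry THE PROOF'S MAP (4.3) `J : ℂ ⊗[M_μ] Ω(μ) → H`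
with its printed property `hJinj : Function.Injective J` («(4.3) … we obtain an isomorphism», proof of Thm. 4.18, l. 2252–2266 — there
via the comparison theorem and [Fal83]) as a BINDER.  `Map43Injective.lean` (this lineage) proves that injectivity by linear algebra
once (4.3) is presented HONESTLY, i.e. as «`z ⊗ f ↦ z · f^*α`» (l. 2249–2250) through rational `H¹`.  THIS FILE is the composition:
the r8 shape at one `μ` (and pin-3's `hblock`-form) with the binder `hJinj` REPLACED by that presentation —

* a `ℚ`-form `L` of `H¹_{B,τ'}(A_μ, ℂ)` which is a LINE over `M_μ` ⟨`H¹_B(A_μ ⊗_{E,τ'} ℂ; ℚ)`; Def. 4.5 (`i_μ` a CM structure, l. 1948)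
  + l. 650 («`A_μ` has dimension `[M_μ:ℚ]/2`») — the rational form of l. 2249 «has dimension 1»⟩, finite-dimensional over `ℚ`;
* a `ℚ`-space `U` with an injective `ℂ`-linear `ι : ℂ ⊗_ℚ U → H` ⟨`H¹_B(A_∞; ℚ)` (or a level) with the comparison into the consumer's
  `H = H¹_{B,τ'}(A_∞, ℂ)`⟩;
* the rational pull-back `P : Ω(μ) → Hom_ℚ(L, U)`, `f ↦ f^*`, additive, `M_μ`-semilinear (`P (m • f) l = P f (m • l)`, contravariance)
  and INJECTIVE ⟨faithfulness of `H¹_B(−; ℚ)` on `Hom ⊗ ℚ`; tree `AbelianVariety.hom_eq_of_complexBetti_map_one_eq`⟩;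
* Liu's `α ∈ ℂ ⊗_ℚ L`, `α ≠ 0`, on which `M_μ` acts through `M_μ ⊆ ℂ` (l. 2249), and the literal formula
  `J (z ⊗ f) = ι (z • (f^*)_ℂ α)` (l. 2250).

Every other binder is passed through unchanged (`h : Thm418AsPrinted D`, `Dμ`, the level family, `resW`/`cmCl`, `hJ` = «`ℂ[𝔾(𝔸_F^∞)]`-linear»
l. 2250, `hpin` = Lem. 2.4 (1) + functoriality, `hnv` = Def. 4.11 / Lem. D.1 (1), `hmult` = proof of Prop. 4.13 l. 2145, resp.
`hblock`).  Theorems only (two compositions); no definition, no named fact; nothing about Liu's objects is constructed — `L`, `U`, `P`,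
`α`, `ι` are the consumer's honest carriers.  HC_CM is NOT proved; no pin is discharged here.
Seat prover-pub-hodgecm2-tr-prover-6-g4-0 (item-(vi) END-display lineage), 2026-08-21.

## References
* [Liu2021] Thm. 4.18 (l. 2232–2245), proof and map (4.3) (l. 2247–2266, esp. l. 2249–2250); Prop. 4.13 with proof l. 2145; Lem. 2.4
  (1) (l. 1210–1213); Def. 4.5 (l. 1948); Def. 4.11; l. 650.
* Tree: `Liu2021.Map43Injective` (`Thm418Data.injective_map43_of_eigenPullback`), `Liu2021.Thm418BlockLeRange` (capstone),
  `Liu2021.Thm418CombinedReading` (pin-3's bridge), `Liu2021.Thm418AsPrinted` (p277833).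
-/

noncomputable section

open scoped TensorProduct
open TensorProduct Module NumberField

namespace Literature.NumberTheory.Automorphic.Liu2021

namespace Thm418Data

variable {F E : Type} [Field F] [NumberField F] [IsTotallyReal F] [Field E] [NumberField E] [Algebra F E]
  [IsTotallyComplex E] [Algebra.IsQuadraticExtension F E] {D : Thm418Data F E}

/-- **pin-3's bridge (`hblock` form, arbitrary action) with (4.3) presented through rational `H¹` — no `hJinj` binder.**
`Thm418Data.block_resW_mem_span_of_thm418AsPrinted_act` with `hJinj : Function.Injective J` REPLACED by the honest presentation of
(4.3): `L` a `ℚ`-form of `H¹_{B,τ'}(A_μ, ℂ)` that is an `M_μ`-line (Def. 4.5 + l. 650), `U` a `ℚ`-space with an injective comparison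
`ι : ℂ ⊗_ℚ U → H`, the rational pull-back `P` («`f ↦ f^*`», `M_μ`-semilinear, injective = faithfulness), Liu's eigenvector `α ≠ 0`
(l. 2249), and `J (z ⊗ f) = ι (z • (f^*)_ℂ α)` (l. 2250); injectivity of `J` is then `Thm418Data.injective_map43_of_eigenPullback`.
Conclusion unchanged: below some level, every `Kof K`-fixed vector of `block ≤ range J` restricts into `span ℂ (cmCl K)`.
HC_CM is NOT proved. [cite: Liu2021, Thm. 4.18 (1) (FJcycle.tex l. 2238–2239) with proof map (4.3) (l. 2247–2266); Lem. 2.4 (1) (l. 1210–1213)] -/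
theorem block_resW_mem_span_of_thm418AsPrinted_act_of_eigenPullback (h : Liu2021.Thm418AsPrinted D) (Dμ : D.Obj)
    {Lvl : Type*} [Preorder Lvl] (Kof : Lvl → Subgroup D.G)
    (hmono : ∀ ⦃K K' : Lvl⦄, K ≤ K' → Kof K ≤ Kof K') (hoc : ∀ K : Lvl, IsOpenCompact (Kof K))
    (hcof : ∀ K' : Subgroup D.G, IsOpenCompact K' → ∃ K₀ : Lvl, Kof K₀ ≤ K')
    {H : Type*} [AddCommGroup H] [Module ℂ H] (act : D.G → H → H)
    {W : Lvl → Type*} [∀ K, AddCommGroup (W K)] [∀ K, Module ℂ (W K)]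
    (resW : ∀ K : Lvl, H →ₗ[ℂ] W K) (cmCl : ∀ K : Lvl, Set (W K))
    -- the honest presentation of (4.3)
    {L : Type*} [AddCommGroup L] [Module ℚ L] [Module (fieldOfValues E D.μ) L] [IsScalarTower ℚ (fieldOfValues E D.μ) L]
    [Module.Finite ℚ L] (hL : Module.finrank (fieldOfValues E D.μ) L = 1)
    {U : Type*} [AddCommGroup U] [Module ℚ U]
    (P : D.Ω →+ (L →ₗ[ℚ] U))
    (hPM : ∀ (m : fieldOfValues E D.μ) (f : D.Ω) (l : L), P (m • f) l = P f (m • l))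
    (hP : Function.Injective P)
    (α : ℂ ⊗[ℚ] L) (hα0 : α ≠ 0)
    (hα : ∀ m : fieldOfValues E D.μ,
      (DistribSMul.toLinearMap ℚ L m).baseChange ℂ α = algebraMap (fieldOfValues E D.μ) ℂ m • α)
    (ι : ℂ ⊗[ℚ] U →ₗ[ℂ] H) (hι : Function.Injective ι)
    (J : ℂ ⊗[fieldOfValues E D.μ] D.Ω →ₗ[ℂ] H)
    (hJ43 : ∀ (z : ℂ) (f : D.Ω), J (z ⊗ₜ[fieldOfValues E D.μ] f) = ι (z • (P f).baseChange ℂ α))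
    -- the remaining binders of pin-3's bridge, unchanged
    (hJ : ∀ (g : D.G) (x : ℂ ⊗[fieldOfValues E D.μ] D.Ω), J ((D.rhoΩ g).baseChange ℂ x) = act g (J x))
    (hpin : ∀ (K : Lvl) (φ : D.HomK (Kof K) Dμ),
      resW K (J ((1 : ℂ) ⊗ₜ[fieldOfValues E D.μ] D.res (Kof K) Dμ φ)) ∈ cmCl K)
    (block : Submodule ℂ H) (hblock : block ≤ LinearMap.range J) :
    ∃ K₀ : Lvl, ∀ K ≤ K₀, ∀ x ∈ block, (∀ k ∈ Kof K, act k x = x) → resW K x ∈ Submodule.span ℂ (cmCl K) :=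
  block_resW_mem_span_of_thm418AsPrinted_act h Dμ Kof hmono hoc hcof act resW cmCl J hJ
    (injective_map43_of_eigenPullback hL P hPM hP α hα0 hα ι hι J hJ43) hpin block hblock

/-- **The combined reading r8 at one `μ` from [Liu2021] Thm. 4.18 AS PRINTED, rank-one branch, with (4.3) presented through rational
`H¹` — NO `Φ`, NO `hblock`, NO `hJinj` binder.**  `Thm418Data.iSup_range_resW_mem_span_of_thm418AsPrinted_of_rank_le_one`
(`Thm418BlockLeRange.lean`) with `hJinj` REPLACED by the honest presentation of (4.3) (as in
`block_resW_mem_span_of_thm418AsPrinted_act_of_eigenPullback`).  REMAINING BINDERS: `h` = Thm. 4.18 EXACTLY AS PRINTED; `Dμ ∈ 𝒜(μ)`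
(Prop. 4.6 (1)); the level family; the consumer's `ℂ[𝔾(𝔸_F^∞)]`-module `H` with `resW`/`cmCl`; the rational presentation {`L` an
`M_μ`-line (Def. 4.5 + l. 650), `U` + injective comparison `ι`, `P = (f ↦ f^*)` semilinear + injective (faithfulness), `α ≠ 0` eigen
(l. 2249), the formula `hJ43` (l. 2250)}; `hJ` («`ℂ[𝔾(𝔸_F^∞)]`-linear», l. 2250); `hpin` (Lem. 2.4 (1) + functoriality); `hnv`
(Def. 4.11 / Lem. D.1 (1)); `hmult` (proof of Prop. 4.13, l. 2145).  CONCLUSION = the package's `Thm418Combined res cmCl` at this `μ` for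
the intrinsic block `⨆_i ⨆_{ψ : ω_i.asModule →ₗ[ℂ[G]] H} range ψ`.  HC_CM is NOT proved; no pin is discharged here.
[cite: Liu2021, Thm. 4.18 (l. 2232–2245) with proof map (4.3) (l. 2247–2266); Prop. 4.13, proof l. 2145; Lem. 2.4 (1) (l. 1210–1213); Def. 4.11] -/
theorem iSup_range_resW_mem_span_of_thm418AsPrinted_of_eigenPullback (h : Liu2021.Thm418AsPrinted D) (Dμ : D.Obj)
    {Lvl : Type*} [Preorder Lvl] (Kof : Lvl → Subgroup D.G)
    (hmono : ∀ ⦃K K' : Lvl⦄, K ≤ K' → Kof K ≤ Kof K') (hoc : ∀ K : Lvl, IsOpenCompact (Kof K))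
    (hcof : ∀ K' : Subgroup D.G, IsOpenCompact K' → ∃ K₀ : Lvl, Kof K₀ ≤ K')
    {H : Type*} [AddCommGroup H] [Module ℂ H] [Module (MonoidAlgebra ℂ D.G) H] [IsScalarTower ℂ (MonoidAlgebra ℂ D.G) H]
    {W : Lvl → Type*} [∀ K, AddCommGroup (W K)] [∀ K, Module ℂ (W K)]
    (resW : ∀ K : Lvl, H →ₗ[ℂ] W K) (cmCl : ∀ K : Lvl, Set (W K))
    -- the honest presentation of (4.3)
    {L : Type*} [AddCommGroup L] [Module ℚ L] [Module (fieldOfValues E D.μ) L] [IsScalarTower ℚ (fieldOfValues E D.μ) L]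
    [Module.Finite ℚ L] (hL : Module.finrank (fieldOfValues E D.μ) L = 1)
    {U : Type*} [AddCommGroup U] [Module ℚ U]
    (P : D.Ω →+ (L →ₗ[ℚ] U))
    (hPM : ∀ (m : fieldOfValues E D.μ) (f : D.Ω) (l : L), P (m • f) l = P f (m • l))
    (hP : Function.Injective P)
    (α : ℂ ⊗[ℚ] L) (hα0 : α ≠ 0)
    (hα : ∀ m : fieldOfValues E D.μ,
      (DistribSMul.toLinearMap ℚ L m).baseChange ℂ α = algebraMap (fieldOfValues E D.μ) ℂ m • α)
    (ι : ℂ ⊗[ℚ] U →ₗ[ℂ] H) (hι : Function.Injective ι)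
    (J : ℂ ⊗[fieldOfValues E D.μ] D.Ω →ₗ[ℂ] H)
    (hJ43 : ∀ (z : ℂ) (f : D.Ω), J (z ⊗ₜ[fieldOfValues E D.μ] f) = ι (z • (P f).baseChange ℂ α))
    -- the remaining binders of the capstone, unchanged
    (hJ : ∀ (g : D.G) (x : ℂ ⊗[fieldOfValues E D.μ] D.Ω), J ((D.rhoΩ g).baseChange ℂ x) = MonoidAlgebra.of ℂ D.G g • J x)
    (hpin : ∀ (K : Lvl) (φ : D.HomK (Kof K) Dμ),
      resW K (J ((1 : ℂ) ⊗ₜ[fieldOfValues E D.μ] D.res (Kof K) Dμ φ)) ∈ cmCl K)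
    (hnv : ∀ i : D.AdmIndex, Nontrivial (D.omegaAt i))
    (hmult : ∀ i : D.AdmIndex, Module.rank ℂ ((D.rhoAt i).asModule →ₗ[MonoidAlgebra ℂ D.G] H) ≤ 1) :
    ∃ K₀ : Lvl, ∀ K ≤ K₀,
      ∀ x ∈ (⨆ i : D.AdmIndex, ⨆ ψ : (D.rhoAt i).asModule →ₗ[MonoidAlgebra ℂ D.G] H, (LinearMap.range ψ).restrictScalars ℂ),
        (∀ k ∈ Kof K, MonoidAlgebra.of ℂ D.G k • x = x) → resW K x ∈ Submodule.span ℂ (cmCl K) :=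
  iSup_range_resW_mem_span_of_thm418AsPrinted_of_rank_le_one h Dμ Kof hmono hoc hcof resW cmCl J hJ
    (injective_map43_of_eigenPullback hL P hPM hP α hα0 hα ι hι J hJ43) hpin hnv hmult

/-- **The same with multiplicity one in the record's currency** (bundled intertwining maps into `ofModule' H`, LITERALLY
`Prop413Data.MultOneAsPrinted.rank_intertwiningMap_le_one` at the consumer's pin), (4.3) through rational `H¹`, no `hJinj`.
HC_CM is NOT proved. [cite: Liu2021, Thm. 4.18 (l. 2232–2245) with proof map (4.3) (l. 2247–2266); Prop. 4.13, proof l. 2145; Lem. 2.4 (1) (l. 1210–1213); Def. 4.11] -/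
theorem iSup_range_resW_mem_span_of_thm418AsPrinted_of_eigenPullback_of_rank_intertwiningMap_le_one
    (h : Liu2021.Thm418AsPrinted D) (Dμ : D.Obj)
    {Lvl : Type*} [Preorder Lvl] (Kof : Lvl → Subgroup D.G)
    (hmono : ∀ ⦃K K' : Lvl⦄, K ≤ K' → Kof K ≤ Kof K') (hoc : ∀ K : Lvl, IsOpenCompact (Kof K))
    (hcof : ∀ K' : Subgroup D.G, IsOpenCompact K' → ∃ K₀ : Lvl, Kof K₀ ≤ K')
    {H : Type*} [AddCommGroup H] [Module ℂ H] [Module (MonoidAlgebra ℂ D.G) H] [IsScalarTower ℂ (MonoidAlgebra ℂ D.G) H]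
    {W : Lvl → Type*} [∀ K, AddCommGroup (W K)] [∀ K, Module ℂ (W K)]
    (resW : ∀ K : Lvl, H →ₗ[ℂ] W K) (cmCl : ∀ K : Lvl, Set (W K))
    {L : Type*} [AddCommGroup L] [Module ℚ L] [Module (fieldOfValues E D.μ) L] [IsScalarTower ℚ (fieldOfValues E D.μ) L]
    [Module.Finite ℚ L] (hL : Module.finrank (fieldOfValues E D.μ) L = 1)
    {U : Type*} [AddCommGroup U] [Module ℚ U]
    (P : D.Ω →+ (L →ₗ[ℚ] U))
    (hPM : ∀ (m : fieldOfValues E D.μ) (f : D.Ω) (l : L), P (m • f) l = P f (m • l))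
    (hP : Function.Injective P)
    (α : ℂ ⊗[ℚ] L) (hα0 : α ≠ 0)
    (hα : ∀ m : fieldOfValues E D.μ,
      (DistribSMul.toLinearMap ℚ L m).baseChange ℂ α = algebraMap (fieldOfValues E D.μ) ℂ m • α)
    (ι : ℂ ⊗[ℚ] U →ₗ[ℂ] H) (hι : Function.Injective ι)
    (J : ℂ ⊗[fieldOfValues E D.μ] D.Ω →ₗ[ℂ] H)
    (hJ43 : ∀ (z : ℂ) (f : D.Ω), J (z ⊗ₜ[fieldOfValues E D.μ] f) = ι (z • (P f).baseChange ℂ α))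
    (hJ : ∀ (g : D.G) (x : ℂ ⊗[fieldOfValues E D.μ] D.Ω), J ((D.rhoΩ g).baseChange ℂ x) = MonoidAlgebra.of ℂ D.G g • J x)
    (hpin : ∀ (K : Lvl) (φ : D.HomK (Kof K) Dμ),
      resW K (J ((1 : ℂ) ⊗ₜ[fieldOfValues E D.μ] D.res (Kof K) Dμ φ)) ∈ cmCl K)
    (hnv : ∀ i : D.AdmIndex, Nontrivial (D.omegaAt i))
    (hmult : ∀ i : D.AdmIndex,
      Module.rank ℂ (Representation.IntertwiningMap (D.rhoAt i) (Representation.ofModule' (k := ℂ) H)) ≤ 1) :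
    ∃ K₀ : Lvl, ∀ K ≤ K₀,
      ∀ x ∈ (⨆ i : D.AdmIndex, ⨆ ψ : (D.rhoAt i).asModule →ₗ[MonoidAlgebra ℂ D.G] H, (LinearMap.range ψ).restrictScalars ℂ),
        (∀ k ∈ Kof K, MonoidAlgebra.of ℂ D.G k • x = x) → resW K x ∈ Submodule.span ℂ (cmCl K) :=
  iSup_range_resW_mem_span_of_thm418AsPrinted_of_rank_intertwiningMap_le_one h Dμ Kof hmono hoc hcof resW cmCl J hJ
    (injective_map43_of_eigenPullback hL P hPM hP α hα0 hα ι hι J hJ43) hpin hnv hmult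


/-! ## §2 (appended, tr-prover-6 gen 4, after p306697 ✔) — clause (ii) «which is `ℂ[𝔾(𝔸_F^∞)]`-linear» (l. 2250) in BINDER
form over the rational carriers, and the capstone with NEITHER `hJ` NOR `hJinj`

With the proof map (4.3) presented through rational `H¹` (`hJ43 : J (z ⊗ f) = ι (z • (f^*)_ℂ α)`), its `ℂ[𝔾(𝔸_F^∞)]`-linearity is no
longer a property to posit: it FOLLOWS from two DEFINING laws of the rational carriers — the Hecke action on `Ω(μ) = Hom_E(A_∞, A_μ)_ℚ`
and on `H¹_{B,τ'}(A_∞, ℚ)` are both induced by `𝔾(𝔸_F^∞) → Aut_E(A_∞)` (l. 2074, l. 2219), i.e. `(g · f)^* = ρU(g) ∘ f^*`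
(`hPact`), and the comparison `ι : ℂ ⊗_ℚ H¹_B(A_∞; ℚ) → H` intertwines `ρU ⊗ ℂ` with the consumer's action (`hιact`, universal
coefficients are natural).  This is the binder-form twin of the record theorem `Map43RationalData.pb_rhoΩ` / `.hJ`
(`Thm418ProofMapRational.lean`, item6-p1; there over the structure, here over explicit binders so that the kernel-lane capstone
below needs no record).  After this section the r8 shape at one `μ` is a tree theorem whose ONLY non-structural inputs are:
[Liu2021] Thm. 4.18 AS PRINTED, `hnv` (Def. 4.11 / Lem. D.1 (1)), `hmult` (proof of Prop. 4.13, l. 2145), Liu's chosen `α` (l. 2249),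
and the consumer's readings (`Kof`, `resW`/`cmCl`, `hpin`); everything about (4.3) — `J`, «`ℂ[G]`-linear», «injective» — is a
DEFINITION or a THEOREM over {`L` an `M_μ`-line, `U` with its `ℚ`-linear Hecke action `ρU`, `P = (f ↦ f^*)` with `hPM`/`hP`/`hPact`,
the comparison `ι` with `hι`/`hιact`}.  HC_CM is NOT proved; no pin is discharged here. -/

/-- **Clause (ii) of the proof of [Liu2021] Thm. 4.18 — «(4.3) is `ℂ[𝔾(𝔸_F^∞)]`-linear» (l. 2250) — in BINDER form over rational
carriers.**  If the rational pull-back `P = (f ↦ f^*)` intertwines the action on `Ω(μ)` with a `ℚ`-linear action `ρU` on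
`U = H¹_{B,τ'}(A_∞, ℚ)` (`hPact : P (g · f) = ρU g ∘ P f` — both actions induced by `𝔾(𝔸_F^∞) → Aut_E(A_∞)`, l. 2074 / l. 2219) and the
comparison `ι` intertwines `ρU g ⊗ ℂ` with a `ℂ`-linear action `actL g` on the consumer's `H` (`hιact`), then the map (4.3)
`J (z ⊗ f) = ι (z • (f^*)_ℂ α)` satisfies `J ((g ⊗ 1) x) = actL g (J x)`.  Pure bookkeeping (tensor induction); no hypothesis on `α`.
HC_CM is NOT proved. [cite: Liu2021, proof of Thm. 4.18 (FJcycle.tex l. 2250); §4.2 l. 2074; Def. 4.16 l. 2219] -/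
theorem map43_equivariant_of_rationalPullback
    {L : Type*} [AddCommGroup L] [Module ℚ L]
    {U : Type*} [AddCommGroup U] [Module ℚ U]
    (P : D.Ω →+ (L →ₗ[ℚ] U)) (ρU : D.G → (U →ₗ[ℚ] U))
    (hPact : ∀ (g : D.G) (f : D.Ω), P (D.rhoΩ g f) = ρU g ∘ₗ P f)
    (α : ℂ ⊗[ℚ] L)
    {H : Type*} [AddCommGroup H] [Module ℂ H] (ι : ℂ ⊗[ℚ] U →ₗ[ℂ] H) (actL : D.G → (H →ₗ[ℂ] H))
    (hιact : ∀ (g : D.G) (u : ℂ ⊗[ℚ] U), ι ((ρU g).baseChange ℂ u) = actL g (ι u))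
    (J : ℂ ⊗[fieldOfValues E D.μ] D.Ω →ₗ[ℂ] H)
    (hJ43 : ∀ (z : ℂ) (f : D.Ω), J (z ⊗ₜ[fieldOfValues E D.μ] f) = ι (z • (P f).baseChange ℂ α))
    (g : D.G) (x : ℂ ⊗[fieldOfValues E D.μ] D.Ω) :
    J ((D.rhoΩ g).baseChange ℂ x) = actL g (J x) := by
  induction x using TensorProduct.induction_on with
  | zero => simp
  | tmul z f =>
      rw [LinearMap.baseChange_tmul, hJ43, hJ43, hPact, LinearMap.baseChange_comp, LinearMap.comp_apply,
        ← ((ρU g).baseChange ℂ).map_smul, hιact]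
  | add x y hx hy => simp only [map_add, hx, hy]

/-- **pin-3's bridge (`hblock` form) with (4.3) presented through rational `H¹` — NEITHER `hJ` NOR `hJinj` a binder.**
`block_resW_mem_span_of_thm418AsPrinted_act_of_eigenPullback` at a `ℂ`-LINEAR consumer action `actL` (e.g. `ρH g`, or `of g • ·`),
with the equivariance binder `hJ` REPLACED by the carrier laws `hPact` (Hecke law of `f ↦ f^*`) and `hιact` (equivariance of the
comparison) via `map43_equivariant_of_rationalPullback`.  HC_CM is NOT proved.
[cite: Liu2021, Thm. 4.18 (1) (FJcycle.tex l. 2238–2239) with proof map (4.3) (l. 2247–2266); Lem. 2.4 (1) (l. 1210–1213)] -/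
theorem block_resW_mem_span_of_thm418AsPrinted_act_of_rationalPullback (h : Liu2021.Thm418AsPrinted D) (Dμ : D.Obj)
    {Lvl : Type*} [Preorder Lvl] (Kof : Lvl → Subgroup D.G)
    (hmono : ∀ ⦃K K' : Lvl⦄, K ≤ K' → Kof K ≤ Kof K') (hoc : ∀ K : Lvl, IsOpenCompact (Kof K))
    (hcof : ∀ K' : Subgroup D.G, IsOpenCompact K' → ∃ K₀ : Lvl, Kof K₀ ≤ K')
    {H : Type*} [AddCommGroup H] [Module ℂ H] (actL : D.G → (H →ₗ[ℂ] H))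
    {W : Lvl → Type*} [∀ K, AddCommGroup (W K)] [∀ K, Module ℂ (W K)]
    (resW : ∀ K : Lvl, H →ₗ[ℂ] W K) (cmCl : ∀ K : Lvl, Set (W K))
    {L : Type*} [AddCommGroup L] [Module ℚ L] [Module (fieldOfValues E D.μ) L] [IsScalarTower ℚ (fieldOfValues E D.μ) L]
    [Module.Finite ℚ L] (hL : Module.finrank (fieldOfValues E D.μ) L = 1)
    {U : Type*} [AddCommGroup U] [Module ℚ U]
    (P : D.Ω →+ (L →ₗ[ℚ] U))
    (hPM : ∀ (m : fieldOfValues E D.μ) (f : D.Ω) (l : L), P (m • f) l = P f (m • l))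
    (hP : Function.Injective P)
    (ρU : D.G → (U →ₗ[ℚ] U)) (hPact : ∀ (g : D.G) (f : D.Ω), P (D.rhoΩ g f) = ρU g ∘ₗ P f)
    (α : ℂ ⊗[ℚ] L) (hα0 : α ≠ 0)
    (hα : ∀ m : fieldOfValues E D.μ,
      (DistribSMul.toLinearMap ℚ L m).baseChange ℂ α = algebraMap (fieldOfValues E D.μ) ℂ m • α)
    (ι : ℂ ⊗[ℚ] U →ₗ[ℂ] H) (hι : Function.Injective ι)
    (hιact : ∀ (g : D.G) (u : ℂ ⊗[ℚ] U), ι ((ρU g).baseChange ℂ u) = actL g (ι u))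
    (J : ℂ ⊗[fieldOfValues E D.μ] D.Ω →ₗ[ℂ] H)
    (hJ43 : ∀ (z : ℂ) (f : D.Ω), J (z ⊗ₜ[fieldOfValues E D.μ] f) = ι (z • (P f).baseChange ℂ α))
    (hpin : ∀ (K : Lvl) (φ : D.HomK (Kof K) Dμ),
      resW K (J ((1 : ℂ) ⊗ₜ[fieldOfValues E D.μ] D.res (Kof K) Dμ φ)) ∈ cmCl K)
    (block : Submodule ℂ H) (hblock : block ≤ LinearMap.range J) :
    ∃ K₀ : Lvl, ∀ K ≤ K₀, ∀ x ∈ block, (∀ k ∈ Kof K, actL k x = x) → resW K x ∈ Submodule.span ℂ (cmCl K) :=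
  block_resW_mem_span_of_thm418AsPrinted_act_of_eigenPullback h Dμ Kof hmono hoc hcof (fun g x => actL g x) resW cmCl hL P hPM
    hP α hα0 hα ι hι J hJ43 (map43_equivariant_of_rationalPullback P ρU hPact α ι actL hιact J hJ43) hpin block hblock

/-- **The combined reading r8 at one `μ` from [Liu2021] Thm. 4.18 AS PRINTED with (4.3) presented through rational `H¹` — NO `Φ`,
NO `hblock`, NO `hJ`, NO `hJinj` binder.**  `iSup_range_resW_mem_span_of_thm418AsPrinted_of_eigenPullback` with the equivariance binder
`hJ` REPLACED by the carrier laws `hPact` (`(g · f)^* = ρU g ∘ f^*`, l. 2074 / l. 2219) and `hιact` (the comparison intertwines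
`ρU g ⊗ ℂ` with `of g • ·` on the consumer's `ℂ[𝔾(𝔸_F^∞)]`-module `H`).  REMAINING NON-STRUCTURAL BINDERS: `h` = Thm. 4.18 EXACTLY AS
PRINTED; `Dμ` (Prop. 4.6 (1)); `α`, `hα0`, `hα` (Liu's chosen basis of the eigenline, l. 2249); `hnv` (Def. 4.11 / Lem. D.1 (1)); `hmult`
(proof of Prop. 4.13, l. 2145); the consumer's readings `Kof`/`resW`/`cmCl`/`hpin`.  HC_CM is NOT proved; no pin is discharged here.
[cite: Liu2021, Thm. 4.18 (l. 2232–2245) with proof map (4.3) (l. 2247–2266); Prop. 4.13, proof l. 2145; Lem. 2.4 (1) (l. 1210–1213); Def. 4.11] -/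
theorem iSup_range_resW_mem_span_of_thm418AsPrinted_of_rationalPullback (h : Liu2021.Thm418AsPrinted D) (Dμ : D.Obj)
    {Lvl : Type*} [Preorder Lvl] (Kof : Lvl → Subgroup D.G)
    (hmono : ∀ ⦃K K' : Lvl⦄, K ≤ K' → Kof K ≤ Kof K') (hoc : ∀ K : Lvl, IsOpenCompact (Kof K))
    (hcof : ∀ K' : Subgroup D.G, IsOpenCompact K' → ∃ K₀ : Lvl, Kof K₀ ≤ K')
    {H : Type*} [AddCommGroup H] [Module ℂ H] [Module (MonoidAlgebra ℂ D.G) H] [IsScalarTower ℂ (MonoidAlgebra ℂ D.G) H]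
    {W : Lvl → Type*} [∀ K, AddCommGroup (W K)] [∀ K, Module ℂ (W K)]
    (resW : ∀ K : Lvl, H →ₗ[ℂ] W K) (cmCl : ∀ K : Lvl, Set (W K))
    {L : Type*} [AddCommGroup L] [Module ℚ L] [Module (fieldOfValues E D.μ) L] [IsScalarTower ℚ (fieldOfValues E D.μ) L]
    [Module.Finite ℚ L] (hL : Module.finrank (fieldOfValues E D.μ) L = 1)
    {U : Type*} [AddCommGroup U] [Module ℚ U]
    (P : D.Ω →+ (L →ₗ[ℚ] U))
    (hPM : ∀ (m : fieldOfValues E D.μ) (f : D.Ω) (l : L), P (m • f) l = P f (m • l))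
    (hP : Function.Injective P)
    (ρU : D.G → (U →ₗ[ℚ] U)) (hPact : ∀ (g : D.G) (f : D.Ω), P (D.rhoΩ g f) = ρU g ∘ₗ P f)
    (α : ℂ ⊗[ℚ] L) (hα0 : α ≠ 0)
    (hα : ∀ m : fieldOfValues E D.μ,
      (DistribSMul.toLinearMap ℚ L m).baseChange ℂ α = algebraMap (fieldOfValues E D.μ) ℂ m • α)
    (ι : ℂ ⊗[ℚ] U →ₗ[ℂ] H) (hι : Function.Injective ι)
    (hιact : ∀ (g : D.G) (u : ℂ ⊗[ℚ] U), ι ((ρU g).baseChange ℂ u) = MonoidAlgebra.of ℂ D.G g • ι u)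
    (J : ℂ ⊗[fieldOfValues E D.μ] D.Ω →ₗ[ℂ] H)
    (hJ43 : ∀ (z : ℂ) (f : D.Ω), J (z ⊗ₜ[fieldOfValues E D.μ] f) = ι (z • (P f).baseChange ℂ α))
    (hpin : ∀ (K : Lvl) (φ : D.HomK (Kof K) Dμ),
      resW K (J ((1 : ℂ) ⊗ₜ[fieldOfValues E D.μ] D.res (Kof K) Dμ φ)) ∈ cmCl K)
    (hnv : ∀ i : D.AdmIndex, Nontrivial (D.omegaAt i))
    (hmult : ∀ i : D.AdmIndex, Module.rank ℂ ((D.rhoAt i).asModule →ₗ[MonoidAlgebra ℂ D.G] H) ≤ 1) :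
    ∃ K₀ : Lvl, ∀ K ≤ K₀,
      ∀ x ∈ (⨆ i : D.AdmIndex, ⨆ ψ : (D.rhoAt i).asModule →ₗ[MonoidAlgebra ℂ D.G] H, (LinearMap.range ψ).restrictScalars ℂ),
        (∀ k ∈ Kof K, MonoidAlgebra.of ℂ D.G k • x = x) → resW K x ∈ Submodule.span ℂ (cmCl K) :=
  iSup_range_resW_mem_span_of_thm418AsPrinted_of_eigenPullback h Dμ Kof hmono hoc hcof resW cmCl hL P hPM hP α hα0 hα ι hι J hJ43
    (map43_equivariant_of_rationalPullback P ρU hPact α ι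
      (fun g => DistribSMul.toLinearMap ℂ H (MonoidAlgebra.of ℂ D.G g)) hιact J hJ43)
    hpin hnv hmult

/-- **The same with multiplicity one in the record's currency** (bundled intertwining maps into `ofModule' H`), (4.3) through rational
`H¹`, NO `hJ`, NO `hJinj`.  HC_CM is NOT proved.
[cite: Liu2021, Thm. 4.18 (l. 2232–2245) with proof map (4.3) (l. 2247–2266); Prop. 4.13, proof l. 2145; Lem. 2.4 (1) (l. 1210–1213); Def. 4.11] -/
theorem iSup_range_resW_mem_span_of_thm418AsPrinted_of_rationalPullback_of_rank_intertwiningMap_le_one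
    (h : Liu2021.Thm418AsPrinted D) (Dμ : D.Obj)
    {Lvl : Type*} [Preorder Lvl] (Kof : Lvl → Subgroup D.G)
    (hmono : ∀ ⦃K K' : Lvl⦄, K ≤ K' → Kof K ≤ Kof K') (hoc : ∀ K : Lvl, IsOpenCompact (Kof K))
    (hcof : ∀ K' : Subgroup D.G, IsOpenCompact K' → ∃ K₀ : Lvl, Kof K₀ ≤ K')
    {H : Type*} [AddCommGroup H] [Module ℂ H] [Module (MonoidAlgebra ℂ D.G) H] [IsScalarTower ℂ (MonoidAlgebra ℂ D.G) H]
    {W : Lvl → Type*} [∀ K, AddCommGroup (W K)] [∀ K, Module ℂ (W K)]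
    (resW : ∀ K : Lvl, H →ₗ[ℂ] W K) (cmCl : ∀ K : Lvl, Set (W K))
    {L : Type*} [AddCommGroup L] [Module ℚ L] [Module (fieldOfValues E D.μ) L] [IsScalarTower ℚ (fieldOfValues E D.μ) L]
    [Module.Finite ℚ L] (hL : Module.finrank (fieldOfValues E D.μ) L = 1)
    {U : Type*} [AddCommGroup U] [Module ℚ U]
    (P : D.Ω →+ (L →ₗ[ℚ] U))
    (hPM : ∀ (m : fieldOfValues E D.μ) (f : D.Ω) (l : L), P (m • f) l = P f (m • l))
    (hP : Function.Injective P)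
    (ρU : D.G → (U →ₗ[ℚ] U)) (hPact : ∀ (g : D.G) (f : D.Ω), P (D.rhoΩ g f) = ρU g ∘ₗ P f)
    (α : ℂ ⊗[ℚ] L) (hα0 : α ≠ 0)
    (hα : ∀ m : fieldOfValues E D.μ,
      (DistribSMul.toLinearMap ℚ L m).baseChange ℂ α = algebraMap (fieldOfValues E D.μ) ℂ m • α)
    (ι : ℂ ⊗[ℚ] U →ₗ[ℂ] H) (hι : Function.Injective ι)
    (hιact : ∀ (g : D.G) (u : ℂ ⊗[ℚ] U), ι ((ρU g).baseChange ℂ u) = MonoidAlgebra.of ℂ D.G g • ι u)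
    (J : ℂ ⊗[fieldOfValues E D.μ] D.Ω →ₗ[ℂ] H)
    (hJ43 : ∀ (z : ℂ) (f : D.Ω), J (z ⊗ₜ[fieldOfValues E D.μ] f) = ι (z • (P f).baseChange ℂ α))
    (hpin : ∀ (K : Lvl) (φ : D.HomK (Kof K) Dμ),
      resW K (J ((1 : ℂ) ⊗ₜ[fieldOfValues E D.μ] D.res (Kof K) Dμ φ)) ∈ cmCl K)
    (hnv : ∀ i : D.AdmIndex, Nontrivial (D.omegaAt i))
    (hmult : ∀ i : D.AdmIndex,
      Module.rank ℂ (Representation.IntertwiningMap (D.rhoAt i) (Representation.ofModule' (k := ℂ) H)) ≤ 1) :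
    ∃ K₀ : Lvl, ∀ K ≤ K₀,
      ∀ x ∈ (⨆ i : D.AdmIndex, ⨆ ψ : (D.rhoAt i).asModule →ₗ[MonoidAlgebra ℂ D.G] H, (LinearMap.range ψ).restrictScalars ℂ),
        (∀ k ∈ Kof K, MonoidAlgebra.of ℂ D.G k • x = x) → resW K x ∈ Submodule.span ℂ (cmCl K) :=
  iSup_range_resW_mem_span_of_thm418AsPrinted_of_eigenPullback_of_rank_intertwiningMap_le_one h Dμ Kof hmono hoc hcof resW cmCl
    hL P hPM hP α hα0 hα ι hι J hJ43
    (map43_equivariant_of_rationalPullback P ρU hPact α ι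
      (fun g => DistribSMul.toLinearMap ℂ H (MonoidAlgebra.of ℂ D.G g)) hιact J hJ43)
    hpin hnv hmult


/-! ## §3 (appended) — the class identification `hpin` DISCHARGED for Liu's own classes `(φ^*α)|_K`

In the binder-form capstones the only remaining «reading» that mentions (4.3) is `hpin`: the level-`K` restriction of
`J (1 ⊗ res_K φ) = φ^*α` (l. 2250 at `z = 1`) is one of the consumer's CM classes.  For LIU'S OWN classes — the set of all
`(φ^*α)|_K := resW K (ι ((φ^*)_ℂ α))`, `φ ∈ Hom_E(A_K, A_μ)_ℚ` (Lem. 2.4 (1), l. 1210–1213: `H¹_{B,τ'}(A_K) = H¹_{B,τ'}(X_K)`, and functoriality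
of Betti `H¹`) — `hpin` holds by `rfl`, so the r8 shape at one `μ` holds for the span of Liu's classes with NO class-identification binder;
a consumer whose `cmCl K` CONTAINS these classes (e.g. the package's `cmClasses K μ = ⋃_{d admissible} {f^*α_d}`, which contains the
`d = (A_μ, α)` classes) gets its own statement by `Submodule.span_mono`.  HC_CM is NOT proved; no pin is discharged here. -/

/-- **r8 at one `μ` for LIU'S OWN CM classes `(φ^*α)|_K` — NO `Φ`, `hblock`, `hJ`, `hJinj`, `hpin` binder.**  From [Liu2021] Thm. 4.18
AS PRINTED, the rational presentation of (4.3) {`L` an `M_μ`-line, `U` with its Hecke action `ρU`, `P = (f ↦ f^*)` with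
`hPM`/`hP`/`hPact`, Liu's `α`, the comparison `ι` with `hι`/`hιact`, `J` by its formula `hJ43`}, `hnv` (Def. 4.11 / Lem. D.1 (1)) and
`hmult` (proof of Prop. 4.13, l. 2145): below some level `K₀`, every `Kof K`-fixed vector of the intrinsic `μ`-block of the consumer's
`ℂ[𝔾(𝔸_F^∞)]`-module `H` restricts, under `resW K`, into the `ℂ`-span of the classes `resW K (ι ((φ^*)_ℂ α))`, `φ ∈ Hom_E(A_K, A_μ)_ℚ`
(`= (φ^*α)|_{X_K}` by Lem. 2.4 (1), l. 1210–1213).  For a consumer class set `cmCl K ⊇` these, compose with `Submodule.span_mono`.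
HC_CM is NOT proved. [cite: Liu2021, Thm. 4.18 (l. 2232–2245) with proof map (4.3) (l. 2247–2266); Prop. 4.13, proof l. 2145; Lem. 2.4 (1) (l. 1210–1213); Def. 4.11] -/
theorem iSup_range_resW_mem_span_liuClasses_of_thm418AsPrinted (h : Liu2021.Thm418AsPrinted D) (Dμ : D.Obj)
    {Lvl : Type*} [Preorder Lvl] (Kof : Lvl → Subgroup D.G)
    (hmono : ∀ ⦃K K' : Lvl⦄, K ≤ K' → Kof K ≤ Kof K') (hoc : ∀ K : Lvl, IsOpenCompact (Kof K))
    (hcof : ∀ K' : Subgroup D.G, IsOpenCompact K' → ∃ K₀ : Lvl, Kof K₀ ≤ K')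
    {H : Type*} [AddCommGroup H] [Module ℂ H] [Module (MonoidAlgebra ℂ D.G) H] [IsScalarTower ℂ (MonoidAlgebra ℂ D.G) H]
    {W : Lvl → Type*} [∀ K, AddCommGroup (W K)] [∀ K, Module ℂ (W K)]
    (resW : ∀ K : Lvl, H →ₗ[ℂ] W K)
    {L : Type*} [AddCommGroup L] [Module ℚ L] [Module (fieldOfValues E D.μ) L] [IsScalarTower ℚ (fieldOfValues E D.μ) L]
    [Module.Finite ℚ L] (hL : Module.finrank (fieldOfValues E D.μ) L = 1)
    {U : Type*} [AddCommGroup U] [Module ℚ U]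
    (P : D.Ω →+ (L →ₗ[ℚ] U))
    (hPM : ∀ (m : fieldOfValues E D.μ) (f : D.Ω) (l : L), P (m • f) l = P f (m • l))
    (hP : Function.Injective P)
    (ρU : D.G → (U →ₗ[ℚ] U)) (hPact : ∀ (g : D.G) (f : D.Ω), P (D.rhoΩ g f) = ρU g ∘ₗ P f)
    (α : ℂ ⊗[ℚ] L) (hα0 : α ≠ 0)
    (hα : ∀ m : fieldOfValues E D.μ,
      (DistribSMul.toLinearMap ℚ L m).baseChange ℂ α = algebraMap (fieldOfValues E D.μ) ℂ m • α)
    (ι : ℂ ⊗[ℚ] U →ₗ[ℂ] H) (hι : Function.Injective ι)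
    (hιact : ∀ (g : D.G) (u : ℂ ⊗[ℚ] U), ι ((ρU g).baseChange ℂ u) = MonoidAlgebra.of ℂ D.G g • ι u)
    (J : ℂ ⊗[fieldOfValues E D.μ] D.Ω →ₗ[ℂ] H)
    (hJ43 : ∀ (z : ℂ) (f : D.Ω), J (z ⊗ₜ[fieldOfValues E D.μ] f) = ι (z • (P f).baseChange ℂ α))
    (hnv : ∀ i : D.AdmIndex, Nontrivial (D.omegaAt i))
    (hmult : ∀ i : D.AdmIndex, Module.rank ℂ ((D.rhoAt i).asModule →ₗ[MonoidAlgebra ℂ D.G] H) ≤ 1) :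
    ∃ K₀ : Lvl, ∀ K ≤ K₀,
      ∀ x ∈ (⨆ i : D.AdmIndex, ⨆ ψ : (D.rhoAt i).asModule →ₗ[MonoidAlgebra ℂ D.G] H, (LinearMap.range ψ).restrictScalars ℂ),
        (∀ k ∈ Kof K, MonoidAlgebra.of ℂ D.G k • x = x) →
          resW K x ∈ Submodule.span ℂ
            (Set.range fun φ : D.HomK (Kof K) Dμ => resW K (ι ((P (D.res (Kof K) Dμ φ)).baseChange ℂ α))) :=
  iSup_range_resW_mem_span_of_thm418AsPrinted_of_rationalPullback h Dμ Kof hmono hoc hcof resW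
    (fun K => Set.range fun φ : D.HomK (Kof K) Dμ => resW K (ι ((P (D.res (Kof K) Dμ φ)).baseChange ℂ α)))
    hL P hPM hP ρU hPact α hα0 hα ι hι hιact J hJ43 (fun K φ => ⟨φ, by rw [hJ43, one_smul]⟩) hnv hmult

/-- **The same for any consumer class set containing Liu's classes** (`hcm : (φ^*α)|_K ∈ cmCl K`, stated on the rational formula —
no `J` in it), by `Submodule.span_mono`.  HC_CM is NOT proved.
[cite: Liu2021, Thm. 4.18 (l. 2232–2245) with proof map (4.3) (l. 2247–2266); Prop. 4.13, proof l. 2145; Lem. 2.4 (1) (l. 1210–1213); Def. 4.11] -/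
theorem iSup_range_resW_mem_span_of_thm418AsPrinted_of_liuClasses_subset (h : Liu2021.Thm418AsPrinted D) (Dμ : D.Obj)
    {Lvl : Type*} [Preorder Lvl] (Kof : Lvl → Subgroup D.G)
    (hmono : ∀ ⦃K K' : Lvl⦄, K ≤ K' → Kof K ≤ Kof K') (hoc : ∀ K : Lvl, IsOpenCompact (Kof K))
    (hcof : ∀ K' : Subgroup D.G, IsOpenCompact K' → ∃ K₀ : Lvl, Kof K₀ ≤ K')
    {H : Type*} [AddCommGroup H] [Module ℂ H] [Module (MonoidAlgebra ℂ D.G) H] [IsScalarTower ℂ (MonoidAlgebra ℂ D.G) H]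
    {W : Lvl → Type*} [∀ K, AddCommGroup (W K)] [∀ K, Module ℂ (W K)]
    (resW : ∀ K : Lvl, H →ₗ[ℂ] W K) (cmCl : ∀ K : Lvl, Set (W K))
    {L : Type*} [AddCommGroup L] [Module ℚ L] [Module (fieldOfValues E D.μ) L] [IsScalarTower ℚ (fieldOfValues E D.μ) L]
    [Module.Finite ℚ L] (hL : Module.finrank (fieldOfValues E D.μ) L = 1)
    {U : Type*} [AddCommGroup U] [Module ℚ U]
    (P : D.Ω →+ (L →ₗ[ℚ] U))
    (hPM : ∀ (m : fieldOfValues E D.μ) (f : D.Ω) (l : L), P (m • f) l = P f (m • l))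
    (hP : Function.Injective P)
    (ρU : D.G → (U →ₗ[ℚ] U)) (hPact : ∀ (g : D.G) (f : D.Ω), P (D.rhoΩ g f) = ρU g ∘ₗ P f)
    (α : ℂ ⊗[ℚ] L) (hα0 : α ≠ 0)
    (hα : ∀ m : fieldOfValues E D.μ,
      (DistribSMul.toLinearMap ℚ L m).baseChange ℂ α = algebraMap (fieldOfValues E D.μ) ℂ m • α)
    (ι : ℂ ⊗[ℚ] U →ₗ[ℂ] H) (hι : Function.Injective ι)
    (hιact : ∀ (g : D.G) (u : ℂ ⊗[ℚ] U), ι ((ρU g).baseChange ℂ u) = MonoidAlgebra.of ℂ D.G g • ι u)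
    (J : ℂ ⊗[fieldOfValues E D.μ] D.Ω →ₗ[ℂ] H)
    (hJ43 : ∀ (z : ℂ) (f : D.Ω), J (z ⊗ₜ[fieldOfValues E D.μ] f) = ι (z • (P f).baseChange ℂ α))
    (hcm : ∀ (K : Lvl) (φ : D.HomK (Kof K) Dμ), resW K (ι ((P (D.res (Kof K) Dμ φ)).baseChange ℂ α)) ∈ cmCl K)
    (hnv : ∀ i : D.AdmIndex, Nontrivial (D.omegaAt i))
    (hmult : ∀ i : D.AdmIndex, Module.rank ℂ ((D.rhoAt i).asModule →ₗ[MonoidAlgebra ℂ D.G] H) ≤ 1) :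
    ∃ K₀ : Lvl, ∀ K ≤ K₀,
      ∀ x ∈ (⨆ i : D.AdmIndex, ⨆ ψ : (D.rhoAt i).asModule →ₗ[MonoidAlgebra ℂ D.G] H, (LinearMap.range ψ).restrictScalars ℂ),
        (∀ k ∈ Kof K, MonoidAlgebra.of ℂ D.G k • x = x) → resW K x ∈ Submodule.span ℂ (cmCl K) := by
  obtain ⟨K₀, hK₀⟩ := iSup_range_resW_mem_span_liuClasses_of_thm418AsPrinted h Dμ Kof hmono hoc hcof resW hL P hPM hP ρU
    hPact α hα0 hα ι hι hιact J hJ43 hnv hmult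
  refine ⟨K₀, fun K hK x hx hfix => Submodule.span_mono ?_ (hK₀ K hK x hx hfix)⟩
  rintro _ ⟨φ, rfl⟩
  exact hcm K φ

end Thm418Data

end Literature.NumberTheory.Automorphic.Liu2021

end
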